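/-
Copyright (c) 2026. All rights reserved.
Released under Apache 2.0 license as described in the file LICENSE.
-/
import Summits.HubbardSuperconductivity.HubbardLadder.HubbardOneBodyRows
import Summits.HubbardSuperconductivity.HubbardLadder.Bounds.R1Rows4x4Doped
import Literature.MathematicalPhysics.QuantumLattice.HubbardLangerMattisFourByFour
import Literature.MathematicalPhysics.QuantumLattice.HubbardPairDensityCouplingFloor
import HarnessLib

/-!
# R2 rows (device D21): certified brackets on the double occupancy, the kinetic energy and the
# nearest-neighbour hopping amplitude of the DOPED `4 × 4` Hubbard torus (`N = 14`, `n = 7/8`, `U = 4, 8`)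

HONEST FRAMING: ladder R1–R4 with certified numbers; no claim on H/H₀.

Cell `pub-hubbard`, seat r2 (observable brackets), R2-TABLE §C (doped rows C1/C2). The first DOPED
observable rows of the ladder: the observables are the double-occupancy density
`d = Re⟨ψ, Σ_x n_{x↑}n_{x↓} ψ⟩/16`, the kinetic energy per site `k = Re⟨ψ, H(1,0) ψ⟩/16` and the
bond–spin averaged nearest-neighbour hopping amplitude `ḡ = Re(Σ_σ Σ_{x∼y} ⟨c†_{xσ}c_{yσ}⟩)/128 = -k/8`
of a normalised ground state `ψ` of `H(t = 1, U)` on the `4 × 4` torus in the sector `N = 14`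
(two holes, `n = 7/8`; `t' = 0`), at `U = 4` and `U = 8` — the two doped CALIBRATION points of
R1-TABLE.md (rows `R1.E4x4d.U4`, `R1.E4x4d.U8`, REFEREE.md R-13 item 1).

## Method (kernel ∘ typed certificate nodes; no new mathematics, no new computation)

KERNELS (all PROVED in the tree, any graph, any sector): the concavity / supergradient sandwich
`DoubleOccupancy.doubleOcc_mem_Icc_of_bounds` (`U₁ < U < U₂`, `L₁ ≤ E_N(U₁)`, `E_N(U) ≤ R`,
`L₂ ≤ E_N(U₂)` ⇒ `(L₂ - R)/(U₂ - U) ≤ ⟨D⟩_ψ ≤ (R - L₁)/(U - U₁)`), the kinetic kernels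
`re_expect_kinetic_eq` (`K = E_N(U) - U⟨D⟩`), `groundEnergyAt_zero_le_re_expect_kinetic`,
`re_expect_kinetic_le_of_bounds`, `le_re_expect_kinetic_of_bounds` (`HubbardOneBodyRows`, device D11),
operator positivity `0 ≤ Σ_x n_{x↑}n_{x↓}` (`re_expect_interaction_mem_Icc`), and the Langer–Mattis /
Kennedy–Lieb closed form `LangerMattis.hubbardTorusFour_groundEnergyAt_ge` at `N = 14`, whose value at
`U = 0` is the EXACT free-fermion energy `E_14(0) = -24` (the two holes sit in the zero-energy shell).

CERTIFICATE NODES (typed, `Bounds/TorusDopedN14Rows`, LEAN REQUEST #62; every node an OPEN obligation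
BY NAME, entering as a hypothesis): the INHERITED pub-mbboot sector-SDP LOWER nodes
`torusLower_mbboot_4x4_U4_N14` (`E_14(4) ≥ -5021820746659051749627099/2⁷⁸ = -16.6158110…`) and
`torusLower_mbboot_4x4_U8_N14` (`E_14(8) ≥ -16346566157428008176874831/2⁸⁰ = -13.5215626…`), both
referee-REPLAYED (REFEREE.md R-13 item 1, kit j085765: verifiers A + B ok ∧ equal, planted Gram defect
rejected), and the INHERITED integer-vector Rayleigh UPPER nodes `torusUpper_mbbootB2_4x4_U4_N14`
(`E_14(4) ≤ -8655678979173/2³⁹ = -15.7445883…`) and `torusUpper_mbbootE2_4x4_U8_N14`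
(`E_14(8) ≤ -815606355579/2³⁶ = -11.8686345…`), LOCATED-only (LEAD RULING R18; ED-tight: Shi et al. 2014
Table I exact `-15.7446`, `-11.8688`). Equivalently (`…_of_r1Rows`): the two referee-signed R1 doped
calibration row Props `Bounds.r1Row_4x4_U{4,8}_N14_tp0` (`Bounds/R1Rows4x4Doped`, LEAN REQUEST #68).

No lower node exists at `N = 14` for any `U > 8` (the Langer–Mattis bound is negative-sloped there and
useless away from half filling), so at `U = 8` the lower endpoint of `d` is operator positivity and
the kinetic ceiling is `K ≤ E_14(8)`; at `U = 4` the `U₁ = 0` end is the exact free value.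

Rows (outward 4-decimal renderings of the exact rational endpoints; margins `≥ 9·10⁻⁶`):

| `U` | `d = ⟨D⟩/16`          | `k = Re⟨H(1,0)⟩/16`     | `ḡ = -k/8`            | nodes used                          |
|-----|-----------------------|-------------------------|-----------------------|-------------------------------------|
| 4   | `[0.0347, 0.1290]`    | `[-1.5000, -1.1229]`    | `[0.1403, 0.1875]`    | upper `U=4`, lower `U=8`; `E_14(0) = -24` |
| 8   | `[0, 0.0742]`         | `[-1.3352, -0.7417]`    | `[0.0927, 0.1669]`    | lower `U=4`, upper `U=8`; `D ≥ 0`   |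

Comparators (context, never inputs; no held source tabulates `d` or `k` for the `4 × 4` torus at
`N = 14` — null for `lit search --hybrid "double occupancy 4x4 Hubbard 14 electrons exact
diagonalization"`): the secants of the exact-diagonalisation energies `E_14(0) = -24`,
`E_14(4) = -15.7446`, `E_14(8) = -11.8688` (Shi et al. 2014, Table I), `Δ E/(16 ΔU) = 0.1290` on
`[0, 4]` and `0.0606` on `[4, 8]`, which concavity orders as `d(8) ≤ 0.0606 ≤ d(4) ≤ 0.1290` — consistent
with both rows (the upper endpoint at `U = 4` IS the `[0, 4]` secant: the `U = 4` upper node is ED-tight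
and `E_14(0)` is exact); thermodynamic-limit AFQMC at `n = 0.875` (Qin–Shi–Zhang 2016 §IV) is a
DIFFERENT object. HONEST LABEL: WEAK (a `4 × 4` cluster that exact diagonalisation solves; widths
`0.094` / `0.074` in `d`, `0.38` / `0.59` in `k`); the value is the TYPED composition kernel ∘ signed
certificates at a doped point, where no selection rule (Lieb–Loss–McCann) or sign structure is available.

## References

* R. B. Griffiths, J. Math. Phys. 5 (1964) 1215; T. Koma, H. Tasaki, J. Stat. Phys. 76 (1994)
  745, §1 (concavity in a coupling, one-sided derivatives). [cite: KomaTasaki1994, §1]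
* W. Langer, D. Mattis, Phys. Lett. A 36 (1971) 139; T. Kennedy, E. H. Lieb, Physica A 138
  (1986) 320, Thm 2.1 (the closed-form lower bound). [cite: KennedyLieb1986, Theorem 2.1]
* H. Shi, C. A. Jiménez-Hoyos, R. Rodríguez-Guzmán, G. E. Scuseria, S. Zhang, Phys. Rev. B 89
  (2014) 125129, Table I (`4 × 4`, `7↑ 7↓`, exact column). [cite: ShiEtAl2014, Table I]
* X. Han, arXiv:2006.06002 (2020), §3 (SDP lower certificates). [cite: Han2020Bootstrap, §3]
* H. Tasaki, *Physics and Mathematics of Quantum Many-Body Systems* (2020), §2.1 (variational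
  principle). [cite: Tasaki2020, §2.1]
* E. H. Lieb, M. Loss, R. J. McCann, J. Math. Phys. 34 (1993) 891 (bond sum of the one-body density
  matrix). [cite: LiebLossMccann1993, Theorem eqs. (5)-(6)]
-/

noncomputable section

namespace Summit.HubbardSuperconductivity.HubbardLadder

open Literature.MathematicalPhysics.QuantumLattice Literature.Probability.LatticeModels Matrix
open LangerMattis DoubleOccupancy Bounds

/-! ### Langer–Mattis at `t = 1`, `N = 14`; positivity of the double occupancy -/

/-- Langer–Mattis / Kennedy–Lieb on the `4 × 4` torus at `t = 1`, `N = 14`, `U ≥ 0`, with the two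
square roots replaced by upper enclosures `a ≥ √(16 + U²/16)`, `b ≥ √(4 + U²/16)`:
`3U/2 - 2a - 8b ≤ E_14(U)`. [cite: KennedyLieb1986, Theorem 2.1] -/
theorem groundEnergyAt_four_N14_ge_of_sqrt_le {U a b : ℝ} (hU : 0 ≤ U)
    (ha : Real.sqrt (16 * (1 : ℝ) ^ 2 + (U / 4) ^ 2) ≤ a)
    (hb : Real.sqrt (4 * (1 : ℝ) ^ 2 + (U / 4) ^ 2) ≤ b) :
    U * (3 / 2) - 2 * a - 8 * b ≤ groundEnergyAt (fermionTorusGraph 2 4) 1 U 14 := by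
  have h := hubbardTorusFour_groundEnergyAt_ge 1 U (N := 14) (by norm_num)
  have habs : |U / 4| = U / 4 := abs_of_nonneg (by positivity)
  rw [habs] at h
  push_cast at h
  linarith

/-- `E_14(0) ≥ -24` — the EXACT free-fermion energy of `14` electrons on the `4 × 4` torus (the two
holes sit in the six-fold zero-energy shell), recovered from the Langer–Mattis bound.
[cite: KennedyLieb1986, Theorem 2.1] -/
theorem groundEnergyAt_four_N14_U0_ge :
    (-24 : ℝ) ≤ groundEnergyAt (fermionTorusGraph 2 4) 1 0 14 := by
  have ha : Real.sqrt (16 * (1 : ℝ) ^ 2 + (0 / 4) ^ 2) ≤ 4 :=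
    (Real.sqrt_le_sqrt (by norm_num)).trans_eq (Real.sqrt_sq (by norm_num))
  have hb : Real.sqrt (4 * (1 : ℝ) ^ 2 + (0 / 4) ^ 2) ≤ 2 :=
    (Real.sqrt_le_sqrt (by norm_num)).trans_eq (Real.sqrt_sq (by norm_num))
  have h := groundEnergyAt_four_N14_ge_of_sqrt_le (U := 0) le_rfl ha hb
  linarith

/-- Operator positivity: `0 ≤ Re⟨ψ, Σ_x n_{x↑}n_{x↓} ψ⟩/16` for every vector of the `4 × 4` torus.
[cite: Tasaki2020, §2.1] -/
theorem doubleOcc_four_nonneg (ψ : Fock (Orb (FermionTorus 2 4))) :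
    0 ≤ (expect (∑ x : FermionTorus 2 4, numberOp x 0 * numberOp x 1) ψ).re / 16 :=
  div_nonneg (re_expect_interaction_mem_Icc ψ).1 (by norm_num)

/-! ### Double occupancy at `U = 4`, `N = 14` -/

/-- **R2 row C1.d (exact-hypothesis form).** Doped `4 × 4` Hubbard torus, `t = 1`, `N = 14`, `U = 4`:
if `E_14(4) ≤ -8655678979173/2³⁹` (node `torusUpper_mbbootB2_4x4_U4_N14`) and
`-16346566157428008176874831/2⁸⁰ ≤ E_14(8)` (node `torusLower_mbboot_4x4_U8_N14`), then every
normalised ground state has `⟨D⟩/16 ∈ [0.0347, 0.1290]` (`U₁ = 0` end: the exact free value `-24`).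
[cite: KomaTasaki1994, §1][cite: KennedyLieb1986, Theorem 2.1] -/
theorem doubleOcc_four_N14_U4_mem_Icc_of_bounds {ψ : Fock (Orb (FermionTorus 2 4))}
    (hψ : IsGroundState (hamiltonian (fermionTorusGraph 2 4) 1 4) 14 ψ) (hψ1 : star ψ ⬝ᵥ ψ = 1)
    (hR : groundEnergyAt (fermionTorusGraph 2 4) 1 4 14 ≤ (-8655678979173 : ℝ) / 2 ^ 39)
    (hL₂ : (-16346566157428008176874831 / 2 ^ 80 : ℝ) ≤ groundEnergyAt (fermionTorusGraph 2 4) 1 8 14) :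
    (expect (∑ x : FermionTorus 2 4, numberOp x 0 * numberOp x 1) ψ).re / 16 ∈
      Set.Icc (0.0347 : ℝ) 0.1290 := by
  have h := doubleOcc_mem_Icc_of_bounds (fermionTorusGraph 2 4) 1 4 hψ hψ1
    (U₁ := 0) (U₂ := 8) (by norm_num) (by norm_num) groundEnergyAt_four_N14_U0_ge hR hL₂
  obtain ⟨h1, h2⟩ := h
  constructor
  · have : (0.0347 : ℝ) * 16 ≤
        (-16346566157428008176874831 / 2 ^ 80 - (-8655678979173 : ℝ) / 2 ^ 39) / (8 - 4) := by
      norm_num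
    linarith [this]
  · have : ((-8655678979173 : ℝ) / 2 ^ 39 - -24) / (4 - 0) ≤ (0.1290 : ℝ) * 16 := by norm_num
    linarith [this]

/-- **R2 row C1.d, claim form** (typed nodes `torusUpper_mbbootB2_4x4_U4_N14`,
`torusLower_mbboot_4x4_U8_N14` of `Bounds/TorusDopedN14Rows`): `⟨D⟩/16 ∈ [0.0347, 0.1290]`.
[cite: KomaTasaki1994, §1] -/
theorem doubleOcc_four_N14_U4_mem_Icc_of_claims {ψ : Fock (Orb (FermionTorus 2 4))}
    (hψ : IsGroundState (hamiltonian (fermionTorusGraph 2 4) 1 4) 14 ψ) (hψ1 : star ψ ⬝ᵥ ψ = 1)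
    (h₄ : torusUpper_mbbootB2_4x4_U4_N14) (h₈ : torusLower_mbboot_4x4_U8_N14) :
    (expect (∑ x : FermionTorus 2 4, numberOp x 0 * numberOp x 1) ψ).re / 16 ∈
      Set.Icc (0.0347 : ℝ) 0.1290 :=
  doubleOcc_four_N14_U4_mem_Icc_of_bounds hψ hψ1 (groundEnergyAt_4x4_U4_N14_le_of_claim h₄)
    (groundEnergyAt_4x4_U8_N14_ge_of_claim h₈)

/-- **R2 row C1.d from the two signed R1 doped calibration rows** `r1Row_4x4_U4_N14_tp0`,
`r1Row_4x4_U8_N14_tp0` (`Bounds/R1Rows4x4Doped`): `⟨D⟩/16 ∈ [0.0347, 0.1290]`. [cite: KomaTasaki1994, §1] -/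
theorem doubleOcc_four_N14_U4_mem_Icc_of_r1Rows {ψ : Fock (Orb (FermionTorus 2 4))}
    (hψ : IsGroundState (hamiltonian (fermionTorusGraph 2 4) 1 4) 14 ψ) (hψ1 : star ψ ⬝ᵥ ψ = 1)
    (h₄ : r1Row_4x4_U4_N14_tp0) (h₈ : r1Row_4x4_U8_N14_tp0) :
    (expect (∑ x : FermionTorus 2 4, numberOp x 0 * numberOp x 1) ψ).re / 16 ∈
      Set.Icc (0.0347 : ℝ) 0.1290 := by
  unfold r1Row_4x4_U4_N14_tp0 at h₄
  unfold r1Row_4x4_U8_N14_tp0 at h₈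
  exact doubleOcc_four_N14_U4_mem_Icc_of_bounds hψ hψ1 h₄.2 (le_of_eq_of_le (by norm_num) h₈.1)

/-! ### Double occupancy at `U = 8`, `N = 14` -/

/-- **R2 row C2.d (exact-hypothesis form).** Doped `4 × 4` Hubbard torus, `t = 1`, `N = 14`, `U = 8`:
if `-5021820746659051749627099/2⁷⁸ ≤ E_14(4)` (node `torusLower_mbboot_4x4_U4_N14`) and
`E_14(8) ≤ -815606355579/2³⁶` (node `torusUpper_mbbootE2_4x4_U8_N14`), then every normalised ground
state has `⟨D⟩/16 ∈ [0, 0.0742]` (lower end: operator positivity — no `N = 14` lower node exists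
at any `U > 8`). [cite: KomaTasaki1994, §1] -/
theorem doubleOcc_four_N14_U8_mem_Icc_of_bounds {ψ : Fock (Orb (FermionTorus 2 4))}
    (hψ : IsGroundState (hamiltonian (fermionTorusGraph 2 4) 1 8) 14 ψ) (hψ1 : star ψ ⬝ᵥ ψ = 1)
    (hL₁ : (-5021820746659051749627099 / 2 ^ 78 : ℝ) ≤ groundEnergyAt (fermionTorusGraph 2 4) 1 4 14)
    (hR : groundEnergyAt (fermionTorusGraph 2 4) 1 8 14 ≤ (-815606355579 : ℝ) / 2 ^ 36) :
    (expect (∑ x : FermionTorus 2 4, numberOp x 0 * numberOp x 1) ψ).re / 16 ∈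
      Set.Icc (0 : ℝ) 0.0742 := by
  refine ⟨doubleOcc_four_nonneg ψ, ?_⟩
  have h := groundEnergyAt_sub_le_mul_doubleOcc (fermionTorusGraph 2 4) 1 8 4 hψ hψ1
  have : ((-815606355579 : ℝ) / 2 ^ 36 - (-5021820746659051749627099 / 2 ^ 78 : ℝ)) / (8 - 4) ≤
      (0.0742 : ℝ) * 16 := by
    norm_num
  rw [div_le_iff₀ (by norm_num : (0 : ℝ) < 16)]
  linarith

/-- **R2 row C2.d, claim form** (typed nodes `torusLower_mbboot_4x4_U4_N14`,
`torusUpper_mbbootE2_4x4_U8_N14`): `⟨D⟩/16 ∈ [0, 0.0742]`. [cite: KomaTasaki1994, §1] -/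
theorem doubleOcc_four_N14_U8_mem_Icc_of_claims {ψ : Fock (Orb (FermionTorus 2 4))}
    (hψ : IsGroundState (hamiltonian (fermionTorusGraph 2 4) 1 8) 14 ψ) (hψ1 : star ψ ⬝ᵥ ψ = 1)
    (h₄ : torusLower_mbboot_4x4_U4_N14) (h₈ : torusUpper_mbbootE2_4x4_U8_N14) :
    (expect (∑ x : FermionTorus 2 4, numberOp x 0 * numberOp x 1) ψ).re / 16 ∈
      Set.Icc (0 : ℝ) 0.0742 :=
  doubleOcc_four_N14_U8_mem_Icc_of_bounds hψ hψ1 (groundEnergyAt_4x4_U4_N14_ge_of_claim h₄)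
    (groundEnergyAt_4x4_U8_N14_le_of_claim h₈)

/-- **R2 row C2.d from the two signed R1 doped calibration rows**: `⟨D⟩/16 ∈ [0, 0.0742]`.
[cite: KomaTasaki1994, §1] -/
theorem doubleOcc_four_N14_U8_mem_Icc_of_r1Rows {ψ : Fock (Orb (FermionTorus 2 4))}
    (hψ : IsGroundState (hamiltonian (fermionTorusGraph 2 4) 1 8) 14 ψ) (hψ1 : star ψ ⬝ᵥ ψ = 1)
    (h₄ : r1Row_4x4_U4_N14_tp0) (h₈ : r1Row_4x4_U8_N14_tp0) :
    (expect (∑ x : FermionTorus 2 4, numberOp x 0 * numberOp x 1) ψ).re / 16 ∈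
      Set.Icc (0 : ℝ) 0.0742 := by
  unfold r1Row_4x4_U4_N14_tp0 at h₄
  unfold r1Row_4x4_U8_N14_tp0 at h₈
  exact doubleOcc_four_N14_U8_mem_Icc_of_bounds hψ hψ1 (le_of_eq_of_le (by norm_num) h₄.1) h₈.2

/-! ### Kinetic energy per site `k = Re⟨ψ, H(1,0) ψ⟩/16` and bond average `ḡ = -k/8`, `N = 14` -/

/-- **Row C.K₀ (certificate-free, every `U`)**: every normalised `14`-particle vector of the `4 × 4`
torus has kinetic energy per site `≥ -3/2` (variational principle at `U = 0` and the exact free value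
`E_14(0) = -24`). [cite: Tasaki2020, §2.1][cite: KennedyLieb1986, Theorem 2.1] -/
theorem kineticPerSite_four_N14_ge_free {ψ : Fock (Orb (FermionTorus 2 4))} (hN : IsNParticle 14 ψ)
    (hψ1 : star ψ ⬝ᵥ ψ = 1) : (-3 / 2 : ℝ) ≤ (expect (hamiltonian (fermionTorusGraph 2 4) 1 0) ψ).re / 16 := by
  have h := groundEnergyAt_zero_le_re_expect_kinetic (fermionTorusGraph 2 4) 1 hN hψ1
  have h0 := groundEnergyAt_four_N14_U0_ge
  rw [le_div_iff₀ (by norm_num : (0 : ℝ) < 16)]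
  linarith

/-- **R2 row C1.K, claim form** (`U = 4`, `N = 14`; nodes: upper at `U = 4`, lower at `U = 8`; floor =
the free value): `Re⟨ψ, H(1,0) ψ⟩/16 ∈ [-1.5000, -1.1229]` (ceiling
`(8 E_14(4) - 4 E_14(8))/(4·16)` from the supergradient inequality). [cite: KomaTasaki1994, §1] -/
theorem kineticPerSite_four_N14_U4_mem_Icc_of_claims {ψ : Fock (Orb (FermionTorus 2 4))}
    (hψ : IsGroundState (hamiltonian (fermionTorusGraph 2 4) 1 4) 14 ψ) (hψ1 : star ψ ⬝ᵥ ψ = 1)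
    (h₄ : torusUpper_mbbootB2_4x4_U4_N14) (h₈ : torusLower_mbboot_4x4_U8_N14) :
    (expect (hamiltonian (fermionTorusGraph 2 4) 1 0) ψ).re / 16 ∈ Set.Icc (-1.5000 : ℝ) (-1.1229) := by
  constructor
  · have h := kineticPerSite_four_N14_ge_free hψ.1 hψ1
    linarith
  · have hup := re_expect_kinetic_le_of_bounds (fermionTorusGraph 2 4) 1 4 hψ hψ1
      (by norm_num : (0 : ℝ) ≤ 4) (by norm_num : (4 : ℝ) < 8) (groundEnergyAt_4x4_U4_N14_le_of_claim h₄)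
      (groundEnergyAt_4x4_U8_N14_ge_of_claim h₈)
    rw [div_le_iff₀ (by norm_num : (0 : ℝ) < 16)]
    refine hup.trans ?_
    norm_num

/-- **R2 row C2.K, claim form** (`U = 8`, `N = 14`; nodes: lower at `U = 4`, upper at `U = 8`):
`Re⟨ψ, H(1,0) ψ⟩/16 ∈ [-1.3352, -0.7417]` (floor `(8 E_14(4) - 4 E_14(8))/(4·16)` from the
supergradient inequality; ceiling `K = E_14(8) - 8⟨D⟩ ≤ E_14(8)` from operator positivity — no lower
node at `U > 8`). [cite: KomaTasaki1994, §1] -/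
theorem kineticPerSite_four_N14_U8_mem_Icc_of_claims {ψ : Fock (Orb (FermionTorus 2 4))}
    (hψ : IsGroundState (hamiltonian (fermionTorusGraph 2 4) 1 8) 14 ψ) (hψ1 : star ψ ⬝ᵥ ψ = 1)
    (h₄ : torusLower_mbboot_4x4_U4_N14) (h₈ : torusUpper_mbbootE2_4x4_U8_N14) :
    (expect (hamiltonian (fermionTorusGraph 2 4) 1 0) ψ).re / 16 ∈ Set.Icc (-1.3352 : ℝ) (-0.7417) := by
  constructor
  · have hlo := le_re_expect_kinetic_of_bounds (fermionTorusGraph 2 4) 1 8 hψ hψ1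
      (by norm_num : (0 : ℝ) ≤ 4) (by norm_num : (4 : ℝ) < 8) (groundEnergyAt_4x4_U4_N14_ge_of_claim h₄)
      (groundEnergyAt_4x4_U8_N14_le_of_claim h₈)
    rw [le_div_iff₀ (by norm_num : (0 : ℝ) < 16)]
    refine le_trans ?_ hlo
    norm_num
  · have hK := re_expect_kinetic_eq (fermionTorusGraph 2 4) 1 8 hψ hψ1
    have hD := (re_expect_interaction_mem_Icc ψ).1
    have hE := groundEnergyAt_4x4_U8_N14_le_of_claim h₈
    rw [div_le_iff₀ (by norm_num : (0 : ℝ) < 16), hK]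
    have : (-815606355579 : ℝ) / 2 ^ 36 ≤ (-0.7417 : ℝ) * 16 := by norm_num
    change 0 ≤ (expect (∑ x : FermionTorus 2 4, numberOp x 0 * numberOp x 1) ψ).re at hD
    nlinarith

/-- **R2 row C1.g, claim form** (`U = 4`, `N = 14`, same nodes): bond–spin averaged nearest-neighbour
hopping amplitude `Re(Σ_σ Σ_{x ∼ y} ⟨c†_{xσ} c_{yσ}⟩)/128 ∈ [0.1403, 0.1875]`.
[cite: LiebLossMccann1993, Theorem eqs. (5)-(6)][cite: KomaTasaki1994, §1] -/
theorem bondAvg_four_N14_U4_mem_Icc_of_claims {ψ : Fock (Orb (FermionTorus 2 4))}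
    (hψ : IsGroundState (hamiltonian (fermionTorusGraph 2 4) 1 4) 14 ψ) (hψ1 : star ψ ⬝ᵥ ψ = 1)
    (h₄ : torusUpper_mbbootB2_4x4_U4_N14) (h₈ : torusLower_mbboot_4x4_U8_N14) :
    (∑ x : FermionTorus 2 4, ∑ y : FermionTorus 2 4, ∑ σ : Fin 2,
        if (fermionTorusGraph 2 4).Adj x y then expect (creation (orb x σ) * annihilation (orb y σ)) ψ
        else 0).re / 128 ∈ Set.Icc (0.1403 : ℝ) 0.1875 := by
  have h := bondAvg_four_mem_Icc_of_kinetic (kineticPerSite_four_N14_U4_mem_Icc_of_claims hψ hψ1 h₄ h₈)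
  exact ⟨le_trans (by norm_num) h.1, le_trans h.2 (by norm_num)⟩

/-- **R2 row C2.g, claim form** (`U = 8`, `N = 14`, same nodes): bond–spin averaged nearest-neighbour
hopping amplitude `Re(Σ_σ Σ_{x ∼ y} ⟨c†_{xσ} c_{yσ}⟩)/128 ∈ [0.0927, 0.1669]`.
[cite: LiebLossMccann1993, Theorem eqs. (5)-(6)][cite: KomaTasaki1994, §1] -/
theorem bondAvg_four_N14_U8_mem_Icc_of_claims {ψ : Fock (Orb (FermionTorus 2 4))}
    (hψ : IsGroundState (hamiltonian (fermionTorusGraph 2 4) 1 8) 14 ψ) (hψ1 : star ψ ⬝ᵥ ψ = 1)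
    (h₄ : torusLower_mbboot_4x4_U4_N14) (h₈ : torusUpper_mbbootE2_4x4_U8_N14) :
    (∑ x : FermionTorus 2 4, ∑ y : FermionTorus 2 4, ∑ σ : Fin 2,
        if (fermionTorusGraph 2 4).Adj x y then expect (creation (orb x σ) * annihilation (orb y σ)) ψ
        else 0).re / 128 ∈ Set.Icc (0.0927 : ℝ) 0.1669 := by
  have h := bondAvg_four_mem_Icc_of_kinetic (kineticPerSite_four_N14_U8_mem_Icc_of_claims hψ hψ1 h₄ h₈)
  exact ⟨le_trans (by norm_num) h.1, le_trans h.2 (by norm_num)⟩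

end Summit.HubbardSuperconductivity.HubbardLadder

end
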